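import Summits.QuantumFields.YangMills.Theorems.SwapVirialDeficitBlowUpGnomonicFibreCoercivity
import HarnessLib

/-!
# (B-far), fibre part: the GLOBAL FLOOR `μ′·min(N(w), 1) ≤ F̂(η₀ + ξ(w))` along EVERY fibre direction, no box — the off-tube `η₀ = μ′R²` of
# ✓`laplaceMethod_chart_of_tube_offBound` at every bulk base point (principal sector)
# (free-hands support of ⟨stmt-QuantumFields-24197⟩ `SwapVirialDeficit.SwapGluedStiffness`; (B-far) of LEAD ym-line-sfw-p2 g97's steep-window Morse–Bott plan:
# «`{‖y‖₂ > R}` over `B`: the same global inequalities give `F̂ ≥ λ·min(R², c)` there»)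

The growth ✓`fibre_growth_gnomonic` is stated on the unit box; the underlying inequalities (✓`leadersW_hubStiff_le`, ✓`chartDeficit_ge_sum_follower_frobNorm_sq`) are GLOBAL, and
their weights saturate instead of vanishing: `gnoWtr(x₀,u) ≥ 4·min(|u|²,1)/(2+x₀²)`, `gnomonicW(z) ≥ 2·min(|z|²,1)`, `‖gno⁺(v) − 1‖²_F ≥ min(|v|²,1)` everywhere.  With
`Σ_i min(c_i,1) ≥ min(Σ_i c_i, 1)`:
* `min_le_two_mul_div` (`min(t,1) ≤ 2t/(1+t)`), `gnoWtr_ge_min`, `gnomonicW_ge_min`, `frobNorm_sq_gnoFollower_ge_min`, `min_sum_le_sum_min`;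
* ★★★ `fibre_far_floor_gnomonic` — hub `a ≠ 0`, follower signs `+`, base point `η₀ = (x₀e₀, y₀e₀, 0, 0)`, `μ′` below the four halved growth constants:
  `μ′·min(N(w), 1) ≤ gnoDeficit 0 1 a ε (η₀ + ξ(w))` for EVERY fibre direction `w` — hence `F̂ ≥ μ′R²` off the tube `{N ≤ R²}` (`R ≤ 1`): ★★ `fibre_offTube_floor_gnomonic`.

HONEST LABEL: composition of landed inequalities; ⟨24197⟩ (window-uniform) ∕ ⟨24196⟩ ∕ ⟨24194⟩ ∕ ⟨24497⟩ OPEN; own crux ⟨22884⟩ OPEN (blocked-on ⟨19935⟩); no crux, rung of record or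
summit is proved; the Yang–Mills mass gap is NOT proved; no summit is proved by a line.  THEOREMS ONLY (0 `def`, 0 `sorry`), standard axioms.
Width seat ym-line-sfw-p2-w3 g65 (cell ym-idea-1, free hands), `--supports stmt-QuantumFields-24197`.  References: [cite: Luscher1983, §2]; [folklore].
-/

set_option autoImplicit false

noncomputable section

open MeasureTheory Quaternion
open scoped BigOperators Quaternion
open Literature.MathematicalPhysics.QuantumFieldTheory hiding SU2
open Literature.MathematicalPhysics.QuantumLattice

namespace Summit.QuantumFields.YangMills.Theorems.SwapVirialDeficit.BlowUpRing

open Summit.QuantumFields.YangMills.Theorems.FemtoTransferGap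
open Summit.QuantumFields.YangMills.Theorems.FemtoTransferGap.TT
open Summit.QuantumFields.YangMills.Theorems.VirialFluxGap.RingDeficit
open Summit.QuantumFields.YangMills.Theorems.SwapVirialDeficit.SwapRing
open Summit.QuantumFields.YangMills.Theorems.SwapVirialDeficit.Gnomonic (normSq3 normSq3_nonneg gnomonicW)

variable {L : ℕ} [NeZero L]

/-! ## §1 Saturating minorants -/

omit [NeZero L] in
/-- `min(t, 1) ≤ 2t/(1+t)` for `t ≥ 0`. [folklore] -/
theorem min_le_two_mul_div {t : ℝ} (ht : 0 ≤ t) : min t 1 ≤ 2 * t / (1 + t) := by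
  rw [le_div_iff₀ (by linarith)]
  rcases le_total t 1 with h | h
  · rw [min_eq_left h]; nlinarith
  · rw [min_eq_right h]; nlinarith

omit [NeZero L] in
/-- `gnoWtr(x₀, u₁, u₂) ≥ 4·min(u₁²+u₂², 1)/(2 + x₀²)` everywhere. [folklore] -/
theorem gnoWtr_ge_min (x₀ u₁ u₂ : ℝ) : 4 * min (u₁ ^ 2 + u₂ ^ 2) 1 / (2 + x₀ ^ 2) ≤ gnoWtr (![x₀, u₁, u₂] : Fin 3 → ℝ) := by
  rw [gnoWtr]
  simp only [Fin.sum_univ_three, Matrix.cons_val_zero, Matrix.cons_val_one, Matrix.cons_val_two, Matrix.head_cons, Matrix.tail_cons]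
  have h0 : 0 ≤ u₁ ^ 2 + u₂ ^ 2 := by positivity
  rw [div_le_div_iff₀ (by positivity) (by positivity)]
  rcases le_total (u₁ ^ 2 + u₂ ^ 2) 1 with h | h
  · rw [min_eq_left h]; nlinarith [sq_nonneg x₀]
  · rw [min_eq_right h]; nlinarith [sq_nonneg x₀]

omit [NeZero L] in
/-- `gnomonicW(v) ≥ 2·min(|v|², 1)` everywhere. [folklore] -/
theorem gnomonicW_ge_min (v : Fin 3 → ℝ) : 2 * min (normSq3 v) 1 ≤ gnomonicW v := by
  have h := min_le_two_mul_div (normSq3_nonneg v)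
  rw [gnomonicW]
  calc 2 * min (normSq3 v) 1 ≤ 2 * (2 * normSq3 v / (1 + normSq3 v)) := by linarith
    _ = 4 * normSq3 v / (1 + normSq3 v) := by ring

omit [NeZero L] in
/-- `‖gno⁺(v) − 1‖²_F ≥ min(|v|², 1)` everywhere. [folklore] -/
theorem frobNorm_sq_gnoFollower_ge_min (v : Fin 3 → ℝ) :
    min (normSq3 v) 1 ≤ frobNorm (((quatToSU2 (gnoLetter true v) : SU2) : Matrix (Fin 2) (Fin 2) ℂ) - 1) ^ 2 :=
  (min_le_two_mul_div (normSq3_nonneg v)).trans (gnoFollower_frobNorm_sq_bounds v).1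

omit [NeZero L] in
/-- `min(Σ c_i, 1) ≤ Σ min(c_i, 1)` for non-negative `c_i`. [folklore] -/
theorem min_sum_le_sum_min {ι : Type*} (s : Finset ι) (c : ι → ℝ) (hc : ∀ i ∈ s, 0 ≤ c i) :
    min (∑ i ∈ s, c i) 1 ≤ ∑ i ∈ s, min (c i) 1 := by
  classical
  by_cases hall : ∀ i ∈ s, c i ≤ 1
  · have e : ∑ i ∈ s, min (c i) 1 = ∑ i ∈ s, c i := Finset.sum_congr rfl fun i hi => min_eq_left (hall i hi)
    rw [e]; exact min_le_left _ _
  · simp only [not_forall, not_le, exists_prop] at hall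
    obtain ⟨j, hj, hcj⟩ := hall
    have h1 : min (c j) 1 = 1 := min_eq_right hcj.le
    have h2 : min (c j) 1 ≤ ∑ i ∈ s, min (c i) 1 :=
      Finset.single_le_sum (fun i hi => le_min (hc i hi) zero_le_one) hj
    rw [h1] at h2
    exact (min_le_right _ _).trans h2

omit [NeZero L] in
/-- `min(p + q, 1) ≤ min(p, 1) + min(q, 1)` for `p, q ≥ 0`. [folklore] -/
theorem min_add_le_add_min {p q : ℝ} (hp : 0 ≤ p) (hq : 0 ≤ q) : min (p + q) 1 ≤ min p 1 + min q 1 := by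
  have hl := min_le_left (p + q) 1
  have hr := min_le_right (p + q) 1
  rcases le_total p 1 with h1 | h1 <;> rcases le_total q 1 with h2 | h2
  · have e1 : min p 1 = p := min_eq_left h1
    have e2 : min q 1 = q := min_eq_left h2
    linarith
  · have e1 : min p 1 = p := min_eq_left h1
    have e2 : min q 1 = 1 := min_eq_right h2
    linarith
  · have e1 : min p 1 = 1 := min_eq_right h1
    have e2 : min q 1 = q := min_eq_left h2
    linarith
  · have e1 : min p 1 = 1 := min_eq_right h1
    have e2 : min q 1 = 1 := min_eq_right h2
    linarith

/-- `min(N(w), 1)` is below the sum of the saturated pieces. [folklore] -/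
theorem min_fibreGauge_le_sum_min (w : ((Fin 2 → ℝ) × (Fin 2 → ℝ)) × (Fin 3 → ℝ) × (Fol L → Fin 3 → ℝ)) :
    min (w.1.1 0 ^ 2 + w.1.1 1 ^ 2 + (w.1.2 0 ^ 2 + w.1.2 1 ^ 2) + normSq3 w.2.1 + ∑ f, normSq3 (w.2.2 f)) 1 ≤
      min (w.1.1 0 ^ 2 + w.1.1 1 ^ 2) 1 + min (w.1.2 0 ^ 2 + w.1.2 1 ^ 2) 1 + min (normSq3 w.2.1) 1 + ∑ f, min (normSq3 (w.2.2 f)) 1 := by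
  have hF1 : min (∑ f, normSq3 (w.2.2 f)) 1 ≤ ∑ f, min (normSq3 (w.2.2 f)) 1 :=
    min_sum_le_sum_min Finset.univ (fun f => normSq3 (w.2.2 f)) fun f _ => normSq3_nonneg _
  have hu0 : 0 ≤ w.1.1 0 ^ 2 + w.1.1 1 ^ 2 := by positivity
  have hv0 : 0 ≤ w.1.2 0 ^ 2 + w.1.2 1 ^ 2 := by positivity
  have hz0 := normSq3_nonneg w.2.1
  have hF0 : 0 ≤ ∑ f, normSq3 (w.2.2 f) := Finset.sum_nonneg fun f _ => normSq3_nonneg _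
  have hp1 : 0 ≤ w.1.1 0 ^ 2 + w.1.1 1 ^ 2 + (w.1.2 0 ^ 2 + w.1.2 1 ^ 2) + normSq3 w.2.1 := by linarith
  have hp2 : 0 ≤ w.1.1 0 ^ 2 + w.1.1 1 ^ 2 + (w.1.2 0 ^ 2 + w.1.2 1 ^ 2) := by linarith
  have s1 := min_add_le_add_min (p := w.1.1 0 ^ 2 + w.1.1 1 ^ 2 + (w.1.2 0 ^ 2 + w.1.2 1 ^ 2) + normSq3 w.2.1) (q := ∑ f, normSq3 (w.2.2 f)) hp1 hF0
  have s2 := min_add_le_add_min (p := w.1.1 0 ^ 2 + w.1.1 1 ^ 2 + (w.1.2 0 ^ 2 + w.1.2 1 ^ 2)) (q := normSq3 w.2.1) hp2 hz0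
  have s3 := min_add_le_add_min (p := w.1.1 0 ^ 2 + w.1.1 1 ^ 2) (q := w.1.2 0 ^ 2 + w.1.2 1 ^ 2) hu0 hv0
  linarith

/-! ## §2 The global fibre floor -/

/-- ★★★ **THE GLOBAL FIBRE FLOOR** (principal sector): hub `a ≠ 0`, follower signs `+`, base point `η₀ = ((x₀e₀, y₀e₀), 0, 0)`, and `μ′` below the four halved
growth constants of ✓`fibre_growth_gnomonic`.  Then for EVERY fibre direction `w = ((u,v),z,η_F)` (no box):
`μ′·min(|u|² + |v|² + |z|² + Σ|η_f|², 1) ≤ F̂(η₀ + ξ(w))`. [cite: Luscher1983, §2] -/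
theorem fibre_far_floor_gnomonic {a : ℍ} (ha : a ≠ 0) (ε : GnoSign L) (hε : ε.2.2 = fun _ => true) (x₀ y₀ : ℝ) {μ' : ℝ} (hμ0 : 0 ≤ μ')
    (hμx : μ' ≤ 2 * (2 * (‖a‖⁻¹ * a.re) * (‖a‖⁻¹ * ‖a.im‖)) ^ 2 / ((2 + x₀ ^ 2) * (16200 * (L : ℝ) ^ 6)))
    (hμy : μ' ≤ 2 * (‖a‖⁻¹ * ‖a.im‖) ^ 2 / ((2 + y₀ ^ 2) * (16200 * (L : ℝ) ^ 6)))
    (hμz : μ' ≤ 1 / (16200 * (L : ℝ) ^ 6))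
    (hμF : μ' ≤ (2304 * (L : ℝ) ^ 6 * (Fintype.card (Fol L) : ℝ))⁻¹ / 2)
    (w : ((Fin 2 → ℝ) × (Fin 2 → ℝ)) × (Fin 3 → ℝ) × (Fol L → Fin 3 → ℝ)) :
    μ' * min (w.1.1 0 ^ 2 + w.1.1 1 ^ 2 + (w.1.2 0 ^ 2 + w.1.2 1 ^ 2) + normSq3 w.2.1 + ∑ f, normSq3 (w.2.2 f)) 1 ≤
      gnoDeficit (fun _ => false) (fun _ => 1) a ε
        ((((![x₀, 0, 0] : Fin 3 → ℝ), (![y₀, 0, 0] : Fin 3 → ℝ)), ((0 : Fin 3 → ℝ), (0 : Fol L → Fin 3 → ℝ))) +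
          (((![0, w.1.1 0, w.1.1 1] : Fin 3 → ℝ), (![0, w.1.2 0, w.1.2 1] : Fin 3 → ℝ)), (w.2.1, w.2.2))) := by
  set η : GnoCoord L := ((((![x₀, 0, 0] : Fin 3 → ℝ), (![y₀, 0, 0] : Fin 3 → ℝ)), ((0 : Fin 3 → ℝ), (0 : Fol L → Fin 3 → ℝ))) +
    (((![0, w.1.1 0, w.1.1 1] : Fin 3 → ℝ), (![0, w.1.2 0, w.1.2 1] : Fin 3 → ℝ)), (w.2.1, w.2.2))) with hηdef
  have hη11 : η.1.1 = ![x₀, w.1.1 0, w.1.1 1] := by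
    simp only [hηdef, Prod.fst_add]; funext k; fin_cases k <;> simp
  have hη12 : η.1.2 = ![y₀, w.1.2 0, w.1.2 1] := by
    simp only [hηdef, Prod.fst_add, Prod.snd_add]; funext k; fin_cases k <;> simp
  have hη21 : η.2.1 = w.2.1 := by simp only [hηdef, Prod.snd_add, Prod.fst_add, zero_add]
  have hη22 : η.2.2 = w.2.2 := by simp only [hηdef, Prod.snd_add, zero_add]
  have hL : (0 : ℝ) < L := by exact_mod_cast NeZero.pos L
  -- the saturated pieces
  have hmu0 : 0 ≤ (min (w.1.1 0 ^ 2 + w.1.1 1 ^ 2) 1) := le_min (by positivity) zero_le_one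
  have hmv0 : 0 ≤ (min (w.1.2 0 ^ 2 + w.1.2 1 ^ 2) 1) := le_min (by positivity) zero_le_one
  have hmz0 : 0 ≤ (min (normSq3 w.2.1) 1) := le_min (normSq3_nonneg _) zero_le_one
  have hmF0 : 0 ≤ (∑ f, min (normSq3 (w.2.2 f)) 1) := Finset.sum_nonneg fun f _ => le_min (normSq3_nonneg _) zero_le_one
  -- leaders, globally
  have hlead := leadersW_hubStiff_le (L := L) ha ε η
  rw [hη11, hη12, hη21] at hlead
  have hx := gnoWtr_ge_min x₀ (w.1.1 0) (w.1.1 1)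
  have hy := gnoWtr_ge_min y₀ (w.1.2 0) (w.1.2 1)
  have hz := gnomonicW_ge_min w.2.1
  have hcx : 0 ≤ (2 * (‖a‖⁻¹ * a.re) * (‖a‖⁻¹ * ‖a.im‖)) ^ 2 := sq_nonneg _
  have hcy : 0 ≤ (‖a‖⁻¹ * ‖a.im‖) ^ 2 := sq_nonneg _
  -- followers, globally
  have hgno : gnoDeficit (fun _ => false) (fun _ => 1) a ε η =
      chartDeficit L (fun _ => false) (fun _ => 1) ((blowUpPoint 1 (gnomonicPoint a ε η)).1, fun f => quatToSU2 (gnoLetter true (w.2.2 f))) := by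
    unfold gnoDeficit
    congr 1
    refine Prod.ext rfl ?_
    funext f
    rw [blowUpPoint_one_gnomonicPoint_snd, hε, hη22]
  have hfol0 := chartDeficit_ge_sum_follower_frobNorm_sq (L := L) ((blowUpPoint 1 (gnomonicPoint a ε η)).1, fun f => quatToSU2 (gnoLetter true (w.2.2 f)))
  rw [← hgno] at hfol0
  have hsumF : (∑ f, min (normSq3 (w.2.2 f)) 1) ≤ ∑ f : Fol L, frobNorm (((quatToSU2 (gnoLetter true (w.2.2 f)) : SU2) : Matrix (Fin 2) (Fin 2) ℂ) - 1) ^ 2 :=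
    Finset.sum_le_sum fun f _ => frobNorm_sq_gnoFollower_ge_min (w.2.2 f)
  set F := gnoDeficit (fun _ => false) (fun _ => 1) a ε η with hFdef
  have hKF : 0 < 2304 * (L : ℝ) ^ 6 * (Fintype.card (Fol L) : ℝ) := by
    have hcard : 0 < Fintype.card (Fol L) := by rw [card_fol]; have := Nat.one_le_pow 4 L NeZero.one_le; omega
    positivity
  have hfol : (2304 * (L : ℝ) ^ 6 * (Fintype.card (Fol L) : ℝ))⁻¹ * (∑ f, min (normSq3 (w.2.2 f)) 1) ≤ F :=
    le_trans (mul_le_mul_of_nonneg_left hsumF (inv_nonneg.2 hKF.le)) hfol0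
  -- the four pieces
  have px : μ' * (min (w.1.1 0 ^ 2 + w.1.1 1 ^ 2) 1) ≤ (2 * (‖a‖⁻¹ * a.re) * (‖a‖⁻¹ * ‖a.im‖)) ^ 2 * gnoWtr (![x₀, w.1.1 0, w.1.1 1] : Fin 3 → ℝ) / (2 * (16200 * (L : ℝ) ^ 6)) := by
    have h1 : μ' * (min (w.1.1 0 ^ 2 + w.1.1 1 ^ 2) 1) ≤ 2 * (2 * (‖a‖⁻¹ * a.re) * (‖a‖⁻¹ * ‖a.im‖)) ^ 2 / ((2 + x₀ ^ 2) * (16200 * (L : ℝ) ^ 6)) * (min (w.1.1 0 ^ 2 + w.1.1 1 ^ 2) 1) := mul_le_mul_of_nonneg_right hμx hmu0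
    have h2 : 2 * (2 * (‖a‖⁻¹ * a.re) * (‖a‖⁻¹ * ‖a.im‖)) ^ 2 / ((2 + x₀ ^ 2) * (16200 * (L : ℝ) ^ 6)) * (min (w.1.1 0 ^ 2 + w.1.1 1 ^ 2) 1) =
        (2 * (‖a‖⁻¹ * a.re) * (‖a‖⁻¹ * ‖a.im‖)) ^ 2 * (4 * (min (w.1.1 0 ^ 2 + w.1.1 1 ^ 2) 1) / (2 + x₀ ^ 2)) / (2 * (16200 * (L : ℝ) ^ 6)) := by
      field_simp; ring
    rw [h2] at h1
    exact h1.trans (div_le_div_of_nonneg_right (mul_le_mul_of_nonneg_left hx hcx) (by positivity))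
  have py : μ' * (min (w.1.2 0 ^ 2 + w.1.2 1 ^ 2) 1) ≤ (‖a‖⁻¹ * ‖a.im‖) ^ 2 * gnoWtr (![y₀, w.1.2 0, w.1.2 1] : Fin 3 → ℝ) / (2 * (16200 * (L : ℝ) ^ 6)) := by
    have h1 : μ' * (min (w.1.2 0 ^ 2 + w.1.2 1 ^ 2) 1) ≤ 2 * (‖a‖⁻¹ * ‖a.im‖) ^ 2 / ((2 + y₀ ^ 2) * (16200 * (L : ℝ) ^ 6)) * (min (w.1.2 0 ^ 2 + w.1.2 1 ^ 2) 1) := mul_le_mul_of_nonneg_right hμy hmv0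
    have h2 : 2 * (‖a‖⁻¹ * ‖a.im‖) ^ 2 / ((2 + y₀ ^ 2) * (16200 * (L : ℝ) ^ 6)) * (min (w.1.2 0 ^ 2 + w.1.2 1 ^ 2) 1) =
        (‖a‖⁻¹ * ‖a.im‖) ^ 2 * (4 * (min (w.1.2 0 ^ 2 + w.1.2 1 ^ 2) 1) / (2 + y₀ ^ 2)) / (2 * (16200 * (L : ℝ) ^ 6)) := by
      field_simp; ring
    rw [h2] at h1
    exact h1.trans (div_le_div_of_nonneg_right (mul_le_mul_of_nonneg_left hy hcy) (by positivity))
  have pz : μ' * (min (normSq3 w.2.1) 1) ≤ gnomonicW w.2.1 / (2 * (16200 * (L : ℝ) ^ 6)) := by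
    have h1 : μ' * (min (normSq3 w.2.1) 1) ≤ 1 / (16200 * (L : ℝ) ^ 6) * (min (normSq3 w.2.1) 1) := mul_le_mul_of_nonneg_right hμz hmz0
    have h2 : 1 / (16200 * (L : ℝ) ^ 6) * (min (normSq3 w.2.1) 1) = 2 * (min (normSq3 w.2.1) 1) / (2 * (16200 * (L : ℝ) ^ 6)) := by field_simp
    rw [h2] at h1
    exact h1.trans (div_le_div_of_nonneg_right hz (by positivity))
  have pF : μ' * (∑ f, min (normSq3 (w.2.2 f)) 1) ≤ F / 2 := by
    have h1 : μ' * (∑ f, min (normSq3 (w.2.2 f)) 1) ≤ (2304 * (L : ℝ) ^ 6 * (Fintype.card (Fol L) : ℝ))⁻¹ / 2 * (∑ f, min (normSq3 (w.2.2 f)) 1) := mul_le_mul_of_nonneg_right hμF hmF0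
    have h2 : (2304 * (L : ℝ) ^ 6 * (Fintype.card (Fol L) : ℝ))⁻¹ / 2 * (∑ f, min (normSq3 (w.2.2 f)) 1) = ((2304 * (L : ℝ) ^ 6 * (Fintype.card (Fol L) : ℝ))⁻¹ * (∑ f, min (normSq3 (w.2.2 f)) 1)) / 2 := by ring
    rw [h2] at h1
    exact h1.trans (by linarith)
  have hleadsum : (2 * (‖a‖⁻¹ * a.re) * (‖a‖⁻¹ * ‖a.im‖)) ^ 2 * gnoWtr (![x₀, w.1.1 0, w.1.1 1] : Fin 3 → ℝ) / (2 * (16200 * (L : ℝ) ^ 6)) +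
      (‖a‖⁻¹ * ‖a.im‖) ^ 2 * gnoWtr (![y₀, w.1.2 0, w.1.2 1] : Fin 3 → ℝ) / (2 * (16200 * (L : ℝ) ^ 6)) +
      gnomonicW w.2.1 / (2 * (16200 * (L : ℝ) ^ 6)) ≤ F / 2 := by
    have hlead' : (2 * (‖a‖⁻¹ * a.re) * (‖a‖⁻¹ * ‖a.im‖)) ^ 2 * gnoWtr (![x₀, w.1.1 0, w.1.1 1] : Fin 3 → ℝ) +
        (‖a‖⁻¹ * ‖a.im‖) ^ 2 * gnoWtr (![y₀, w.1.2 0, w.1.2 1] : Fin 3 → ℝ) + gnomonicW w.2.1 ≤ 16200 * (L : ℝ) ^ 6 * F := hlead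
    rw [← add_div, ← add_div, div_le_div_iff₀ (by positivity) (by norm_num : (0 : ℝ) < 2)]
    nlinarith [hlead']
  have hmin := min_fibreGauge_le_sum_min (L := L) w
  calc μ' * min (w.1.1 0 ^ 2 + w.1.1 1 ^ 2 + (w.1.2 0 ^ 2 + w.1.2 1 ^ 2) + normSq3 w.2.1 + ∑ f, normSq3 (w.2.2 f)) 1
      ≤ μ' * ((min (w.1.1 0 ^ 2 + w.1.1 1 ^ 2) 1) + (min (w.1.2 0 ^ 2 + w.1.2 1 ^ 2) 1) + (min (normSq3 w.2.1) 1) + (∑ f, min (normSq3 (w.2.2 f)) 1)) := mul_le_mul_of_nonneg_left hmin hμ0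
    _ = μ' * (min (w.1.1 0 ^ 2 + w.1.1 1 ^ 2) 1) + μ' * (min (w.1.2 0 ^ 2 + w.1.2 1 ^ 2) 1) + μ' * (min (normSq3 w.2.1) 1) + μ' * (∑ f, min (normSq3 (w.2.2 f)) 1) := by ring
    _ ≤ F / 2 + F / 2 := by linarith [px, py, pz, pF, hleadsum]
    _ = F := by ring

/-- ★★ **THE OFF-TUBE FLOOR**: with `0 ≤ R ≤ 1`, every fibre direction with `N(w) ≥ R²` has `μ′·R² ≤ F̂(η₀ + ξ(w))` — the `η₀` of the off-tube bound of
✓`laplaceMethod_chart_of_tube_offBound`, polynomial in `L`, at every bulk base point. [cite: Luscher1983, §2] -/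
theorem fibre_offTube_floor_gnomonic {a : ℍ} (ha : a ≠ 0) (ε : GnoSign L) (hε : ε.2.2 = fun _ => true) (x₀ y₀ : ℝ) {μ' R : ℝ} (hμ0 : 0 ≤ μ')
    (hR : 0 ≤ R) (hR1 : R ≤ 1)
    (hμx : μ' ≤ 2 * (2 * (‖a‖⁻¹ * a.re) * (‖a‖⁻¹ * ‖a.im‖)) ^ 2 / ((2 + x₀ ^ 2) * (16200 * (L : ℝ) ^ 6)))
    (hμy : μ' ≤ 2 * (‖a‖⁻¹ * ‖a.im‖) ^ 2 / ((2 + y₀ ^ 2) * (16200 * (L : ℝ) ^ 6)))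
    (hμz : μ' ≤ 1 / (16200 * (L : ℝ) ^ 6))
    (hμF : μ' ≤ (2304 * (L : ℝ) ^ 6 * (Fintype.card (Fol L) : ℝ))⁻¹ / 2)
    (w : ((Fin 2 → ℝ) × (Fin 2 → ℝ)) × (Fin 3 → ℝ) × (Fol L → Fin 3 → ℝ))
    (hfar : R ^ 2 ≤ w.1.1 0 ^ 2 + w.1.1 1 ^ 2 + (w.1.2 0 ^ 2 + w.1.2 1 ^ 2) + normSq3 w.2.1 + ∑ f, normSq3 (w.2.2 f)) :
    μ' * R ^ 2 ≤
      gnoDeficit (fun _ => false) (fun _ => 1) a ε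
        ((((![x₀, 0, 0] : Fin 3 → ℝ), (![y₀, 0, 0] : Fin 3 → ℝ)), ((0 : Fin 3 → ℝ), (0 : Fol L → Fin 3 → ℝ))) +
          (((![0, w.1.1 0, w.1.1 1] : Fin 3 → ℝ), (![0, w.1.2 0, w.1.2 1] : Fin 3 → ℝ)), (w.2.1, w.2.2))) := by
  have h := fibre_far_floor_gnomonic (L := L) ha ε hε x₀ y₀ hμ0 hμx hμy hμz hμF w
  have hR2 : R ^ 2 ≤ 1 := by nlinarith
  have hmin : R ^ 2 ≤ min (w.1.1 0 ^ 2 + w.1.1 1 ^ 2 + (w.1.2 0 ^ 2 + w.1.2 1 ^ 2) + normSq3 w.2.1 + ∑ f, normSq3 (w.2.2 f)) 1 := le_min hfar hR2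
  exact le_trans (mul_le_mul_of_nonneg_left hmin hμ0) h

end Summit.QuantumFields.YangMills.Theorems.SwapVirialDeficit.BlowUpRing

end
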